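import Literature.AlgebraicGeometry.Frobenioids.TwoLevelFrobenioidIsFrobenioid
import Literature.AlgebraicGeometry.Frobenioids.FiberProductsMetricallyTrivialStatement
import Literature.AlgebraicGeometry.Frobenioids.FiberProductsMorphisms
import HarnessLib

/-!
# Frobenioids I, Proposition 1.6 (v), clause «metrically trivial», direction `C ⇒ C′`: the kernel
# counterexample (abc-iut finding F-t8g2-1, FLAG #19)

Mochizuki, *The geometry of Frobenioids I: the general theory*, Kyushu J. Math. **62** (2008)
293–400, §1, Proposition 1.6 (v), kurims text p. 28 [cite: MochizukiFrdI2008, Prop. 1.6(v) p.28]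
("A object of `C′` is … metrically trivial … if and only if it projects to such an object of `C`";
proof p. 28: "one checks immediately that the equivalences of assertions (iii), (iv), (v) hold").

The printed direction `C ⇒ C′` of the clause «metrically trivial» is the named statement
`PreFrobenioid.Prop16vMetricallyTrivialIf` (`FiberProductsMetricallyTrivialStatement.lean`; typed over
abc-iut-found's `FiberProduct` / `fiberProductFunctor`, whose typer left exactly this clause open —
`FiberProductsMorphisms.lean`, module docstring ll. 38–42).  THIS FILE refutes it:
`TwoLevel.not_prop16vMetricallyTrivialIf`.  Witness: the two-level Frobenioid `C` over `D = B(ℤ/2)`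
(`TwoLevelFrobenioid*.lean`, `TwoLevel.isFrobenioid`), base-changed along `G : pt → D`; the object
`A′ = (low, ∗′, id)` of `C′ = C ×_D pt` projects to the METRICALLY TRIVIAL object `low`, but the
co-angular pre-step `((σ, 1, 1), id) : A′ → (low, ∗′, σ)` of `C′` (co-angular / pre-step by found's
`isCoAngular_fiberProduct_of_fst`, `isPreStep_fiberProduct_iff`) has non-isomorphic ends: an
isomorphism would project to an automorphism of `low` over `σ`, and `Aut(low) = {id}` (`low` is not
`Aut`-ample — precisely the missing "prescribed projection" input).  Equivalently, for `D′ = pt` an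
object `(A, e)` of `C′` is metrically trivial iff `Div : O^▷(A) → Φ(A)` is surjective; for `low` the
image is `2ℤ_{≥0}`.  The hypotheses of Prop. 1.6 hold: `pt` is connected and totally epimorphic and
`G` maps FSM-morphisms to FSM-morphisms (identities).  Neutral record under the cell's typing; the
sibling clause «base-trivial» (same direction) is TRUE (`FiberProductsBaseTrivial.lean`).  Nothing here
bears on [IUTchIII] Cor. 3.12.
-/

namespace Literature.AlgebraicGeometry.Frobenioids

open CategoryTheory Opposite

namespace TwoLevel

open PreFrobenioid

/-- An identity arrow is an FSM-morphism. [cite: MochizukiFrdI2008, §0 p.14] -/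
theorem isFSM_id {C : Type} [Category.{0} C] (A : C) : IsFSM (𝟙 A) :=
  ⟨fun Y γ => ⟨Y, γ, 𝟙 Y, by simp⟩, inferInstance⟩

/-- The witness: over `G : pt → B(ℤ/2)` (constant at `∗`), the object `(low, ∗′, id)` of `C ×_D pt`
projects to a metrically trivial object but is not metrically trivial. [cite: MochizukiFrdI2008, Prop. 1.6(v) p.28] -/
theorem exists_fst_metricallyTrivial_not_metricallyTrivial :
    ∃ (G : Discrete PUnit.{1} ⥤ D) (A' : FiberProduct toElem G),
      (∀ {a b : Discrete PUnit.{1}} (f : a ⟶ b), IsFSM f → IsFSM (G.map f)) ∧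
      IsMetricallyTrivial toElem A'.fst ∧ ¬ IsMetricallyTrivial (fiberProductFunctor toElem G) A' := by
  let G : Discrete PUnit.{1} ⥤ D := (Functor.const _).obj (SingleObj.star X)
  let A' : FiberProduct toElem G := ⟨Obj.low, ⟨PUnit.unit⟩, Iso.refl _⟩
  let B' : FiberProduct toElem G :=
    ⟨Obj.low, ⟨PUnit.unit⟩, ⟨σ, σ, show σ * σ = (1 : X) by decide, show σ * σ = (1 : X) by decide⟩⟩
  -- the co-angular pre-step `((σ, 1, 1), id) : A′ → B′`
  let ψ : A' ⟶ B' :=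
    { fst := lowEnd σ (Multiplicative.ofAdd 1) rfl
      snd := 𝟙 _
      w := show σ * σ = (1 : X) * 1 by decide }
  refine ⟨G, A', fun f _ => isFSM_id _, isMetricallyTrivial_low, fun hmt => ?_⟩
  have hb : IsBaseIso (fiberProductFunctor toElem G) ψ := by
    show IsIso (𝟙 _); exact inferInstance
  have hco : IsCoAngular (fiberProductFunctor toElem G) ψ :=
    isCoAngular_fiberProduct_of_fst ψ (isCoAngular_low _)
  have hps : IsPreStep (fiberProductFunctor toElem G) ψ :=
    (isPreStep_fiberProduct_iff ψ hb).mpr (isPreStep_low _)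
  obtain ⟨i⟩ := hmt ψ hco hps
  -- `i : B′ ≅ A′` projects to an automorphism of `low` over `σ`: impossible
  have h1 : bs i.hom.fst.1 = 1 := @bs_eq_one_of_isIso_low i.hom.fst (CFP.isIso_fst i.hom)
  have w : (1 : X) * bs i.hom.fst.1 = 1 * σ := i.hom.w
  rw [h1, one_mul, one_mul] at w
  exact σ_ne_one w.symm

/-- **Prop. 1.6 (v), «metrically trivial», direction `C ⇒ C′`, is false as printed** (kernel witness:
the two-level Frobenioid over `B(ℤ/2)` and `D′ = pt`). [cite: MochizukiFrdI2008, Prop. 1.6(v) p.28] -/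
theorem not_prop16vMetricallyTrivialIf : ¬ PreFrobenioid.Prop16vMetricallyTrivialIf := by
  intro h
  obtain ⟨G, A', hG, hA, hnot⟩ := exists_fst_metricallyTrivial_not_metricallyTrivial
  exact hnot (h toElem G isFrobenioid StandardFrobenioidExample.isGraphConnected_D
    StandardFrobenioidExample.isTotallyEpimorphic_D (fun f hf => hG f hf) A' hA)

end TwoLevel

end Literature.AlgebraicGeometry.Frobenioids
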